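/-
Copyright: cell pub-balaban-gaps (YM BLITZ Y1, track G1), seat g1-p2 GEN 9 (unit `pub-balaban-gaps-g1-p2`).  Row (D4) NODE O,
OBJECT level: print's block contours `Γ_{y,x}` ([B9] (3.8) p. 392, *"U(Γ_{y,x})"* — the parallel transport along a contour inside the
block from its base point to `x`, entering the averaging operations `Q(U)`) as an EXPLICIT object on the torus `Π_μ[0, N_μ)`: connected
bond paths (`IsPath`), their concatenation and the TELESCOPING of gauge factors along them; the axis-by-axis contour from the block
corner `b·⌊x∕b⌋` to `x` (`blockContour`), which is connected, has `≤ (d+1)(b−1)` bonds, stays inside the `b`-block of `x`, and whose base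
point depends only on the block; and its instance on [4]'s nested family `{Ω_j}` at the level-dependent side `b = L^{lev x}` — discharging
the contour hypotheses of the lineage's Cor. 3.5 ENDs (length, in-block) and of the gauge transfer (connectedness, base constancy).
HONEST FRAMING: elementary lattice geometry; base point = block CORNER (print: a point `y` of the block; any fixed choice is gauge-
equivalent); nothing of Bałaban's asserted; (D4) instance 0∕1; NOT BetaPertH, NOT continuum, NOT Clay.
-/
import Summits.QuantumFields.BalabanUV.Gaps.D4WalkBlock
import Literature.MathematicalPhysics.QuantumFieldTheory.Balaban1983to89.B6MultiLevelTorusOperator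

/-!
# `Gaps.D4WalkBlockContourPath` — connected bond paths, telescoping, and the canonical block contours `Γ_{y,x}` on the torus and on
# [4]'s nested family (cell pub-balaban-gaps, seat g1-p2 gen 9)

HONEST DEPENDENCY (cell pub-balaban, verbatim): continuum YM on T⁴ ⇐ BetaPertH ∧ nine spine estimates (0/9 proved);
BetaPertH ⇐ (D1) ∧ (D4) ∧ CAP+tail.

* §1 **`IsPath sh Γ a b`** (bonds `(y₁,μ₁)…(yₙ,μₙ)`, `y₁ = a`, `y_{i+1} = sh_{μ_i} y_i`, end `b`), `IsPath.append`, and TELESCOPING of gauge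
  factors along a path: **`prod_map_gauge`** (`Π_i g(y_i)U_ig⁻(y_{i+1}) = g(a)(ΠU_i)g⁻(b)`), **`prod_map_gauge_reverse`**.
* §2 on the torus box `Π_μ[0,N_μ)` with the unit translations `tshift N (unitVec μ)`: no-wrap arithmetic (`tshift_unitVec_val`,
  `iterate_tshift_unitVec_val`), straight runs `linePath`, the block corner `corner b x = b·⌊x∕b⌋`, the axis-by-axis contour
  **`blockContour b x`** and its four properties: **`isPath_blockContour`** (connected from `corner b x` to `x`),
  **`length_blockContour_le`** (`≤ (d+1)·(b−1)`), **`blk_eq_of_mem_blockContour`** (inside the `b`-block of `x`), **`corner_eq_of_blk_eq`**.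
* §3 on [4]'s nested family `D : TDomains`: `levContour D x := blockContour (L^{lev x}) x`, `levBase D x := corner (L^{lev x}) x` and the four
  hypotheses of the lineage's ENDs BY NAME: `isPath_levContour`, `levBase_eq_of_blk_eq` (via `TDomains.lev_eq_of_blk_eq`),
  `length_levContour_le` (`≤ (d+1)L^{lev x}`), `blk_eq_of_mem_levContour`.
Value: an explicit object; words of row (D4) UNCHANGED.

References: T. Bałaban, Comm. Math. Phys. **99** (1985) 389–434 [B9], (3.8) p. 392, p. 398; Comm. Math. Phys. **96** (1984) [4], (2.1) p. 224,
(2.13)–(2.14) p. 225.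
-/

noncomputable section

namespace Summit.QuantumFields.BalabanUV.Gaps.D4WalkBlockContourPath

open scoped Matrix
open Literature.MathematicalPhysics.QuantumFieldTheory.Balaban1983to89
open Literature.MathematicalPhysics.QuantumFieldTheory.Balaban1983to89.B4Reflection242 (boxDom blk mem_boxDom)
open Literature.MathematicalPhysics.QuantumFieldTheory.Balaban1983to89.B6MultiLevelBoxOperator (N0)
open Literature.MathematicalPhysics.QuantumFieldTheory.Balaban1983to89.B6MultiLevelTorusOperator (TDomains tshift unitVec twrap
  twrap_eq_self)

/-! ## §1. Connected bond paths and telescoping -/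

section Path

variable {X : Type} {ι : Type}

/-- **Connected bond paths**: `IsPath sh Γ a b` — the bonds `(y₁,μ₁),…,(yₙ,μₙ)` run from `a = y₁` through `y_{i+1} = sh_{μ_i} y_i` to
`b` (`a = b` for the empty path).  An inductive predicate (data-free; the connectivity of print's contours `Γ_{y,x}`).
[cite: Balaban1985BackgroundPropagators, (3.8) p.392] -/
inductive IsPath (sh : ι → X ≃ X) : List (X × ι) → X → X → Prop
  | nil (a : X) : IsPath sh [] a a
  | cons (a : X) (μ : ι) {rest : List (X × ι)} {b : X} (h : IsPath sh rest (sh μ a) b) : IsPath sh ((a, μ) :: rest) a b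

/-- Concatenation of connected paths. -/
theorem IsPath.append {sh : ι → X ≃ X} {Γ₁ Γ₂ : List (X × ι)} {a b c : X} (h1 : IsPath sh Γ₁ a b) (h2 : IsPath sh Γ₂ b c) :
    IsPath sh (Γ₁ ++ Γ₂) a c := by
  induction h1 with
  | nil a => simpa using h2
  | cons a μ h ih => exact IsPath.cons a μ (ih h2)

variable {F : Type} [Fintype F] [DecidableEq F]

/-- **TELESCOPING along a path**: `Π_i g(y_i)U_ig⁻(y_{i+1}) = g(a)·(Π_i U_i)·g⁻(b)`. [cite: Balaban1985BackgroundPropagators, p.398] -/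
theorem prod_map_gauge (sh : ι → X ≃ X) {g gi : X → Matrix F F ℂ} (hgi : ∀ y, gi y * g y = 1) (hg : ∀ y, g y * gi y = 1)
    (U : X × ι → Matrix F F ℂ) {Γ : List (X × ι)} {a b : X} (h : IsPath sh Γ a b) :
    (Γ.map fun bd => g bd.1 * U bd * gi (sh bd.2 bd.1)).prod = g a * (Γ.map U).prod * gi b := by
  induction h with
  | nil a => simp [hg]
  | cons a μ h ih =>
      simp only [List.map_cons, List.prod_cons]
      rw [ih]
      simp only [← Matrix.mul_assoc]
      rw [Matrix.mul_assoc (g a * U (a, μ)) (gi _) (g _), hgi, Matrix.mul_one]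

/-- **TELESCOPING, reverse transporters**: `Π_{i↓} g(y_{i+1})U⁻_ig⁻(y_i) = g(b)·(Π_{i↓} U⁻_i)·g⁻(a)`. [cite: Balaban1985BackgroundPropagators, p.398] -/
theorem prod_map_gauge_reverse (sh : ι → X ≃ X) {g gi : X → Matrix F F ℂ} (hgi : ∀ y, gi y * g y = 1) (hg : ∀ y, g y * gi y = 1)
    (Ui : X × ι → Matrix F F ℂ) {Γ : List (X × ι)} {a b : X} (h : IsPath sh Γ a b) :
    ((Γ.map fun bd => g (sh bd.2 bd.1) * Ui bd * gi bd.1).reverse).prod = g b * ((Γ.map Ui).reverse).prod * gi a := by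
  induction h with
  | nil a => simp [hg]
  | cons a μ h ih =>
      simp only [List.map_cons, List.reverse_cons, List.prod_append, List.prod_cons, List.prod_nil, Matrix.mul_one]
      rw [ih]
      simp only [← Matrix.mul_assoc]
      rw [Matrix.mul_assoc (g _ * (List.map Ui _).reverse.prod) (gi _) (g _), hgi, Matrix.mul_one]

end Path

/-! ## §2. The canonical block contour on the torus box -/

section Torus

variable {d : ℕ} {N : Fin (d + 1) → ℕ}

/-- One unit step along axis `μ` does not wrap when `x_μ + 1 < N_μ`: `(sh_μ x) = x + e_μ`. -/
theorem tshift_unitVec_val (μ : Fin (d + 1)) (p : ↥(boxDom N)) (h : p.1 μ + 1 < N μ) :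
    (tshift N (unitVec μ) p).1 = p.1 + unitVec μ := by
  show twrap N (p.1 + unitVec μ) = p.1 + unitVec μ
  refine twrap_eq_self (mem_boxDom.2 fun i => ?_)
  have hp := (mem_boxDom.1 p.2) i
  by_cases hi : i = μ
  · subst hi; simp only [Pi.add_apply, unitVec, Pi.single_eq_same]; exact ⟨by linarith [hp.1], h⟩
  · simp only [Pi.add_apply, unitVec, Pi.single_eq_of_ne hi, add_zero]; exact hp

/-- `n` unit steps along axis `μ` without wrapping: `(sh_μ^n x) = x + n·e_μ` when `x_μ + n < N_μ`. -/
theorem iterate_tshift_unitVec_val (μ : Fin (d + 1)) : ∀ (n : ℕ) (p : ↥(boxDom N)), p.1 μ + n < N μ →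
    ((tshift N (unitVec μ))^[n] p).1 = p.1 + (n : ℤ) • unitVec μ := by
  intro n
  induction n with
  | zero => intro p _; simp
  | succ n ih =>
      intro p h
      rw [Function.iterate_succ_apply]
      have h1 : p.1 μ + 1 < N μ := by push_cast at h; linarith
      have e1 := tshift_unitVec_val μ p h1
      have h2 : (tshift N (unitVec μ) p).1 μ + n < N μ := by
        rw [e1]; simp only [Pi.add_apply, unitVec, Pi.single_eq_same]; push_cast at h ⊢; linarith
      rw [ih _ h2, e1]
      simp only [add_assoc, Nat.cast_succ, add_smul, one_smul, add_comm (unitVec μ)]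

/-- A straight run of `n` bonds along axis `μ` starting at `p`. -/
def linePath (μ : Fin (d + 1)) : ↥(boxDom N) → ℕ → List (↥(boxDom N) × Fin (d + 1))
  | _, 0 => []
  | p, n + 1 => (p, μ) :: linePath μ (tshift N (unitVec μ) p) n

/-- A straight run is a connected path to `sh_μ^n p`. -/
theorem isPath_linePath (μ : Fin (d + 1)) : ∀ (n : ℕ) (p : ↥(boxDom N)),
    IsPath (fun ν => tshift N (unitVec ν)) (linePath μ p n) p ((tshift N (unitVec μ))^[n] p) := by
  intro n
  induction n with
  | zero => intro p; simpa [linePath] using IsPath.nil p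
  | succ n ih =>
      intro p
      have h := ih (tshift N (unitVec μ) p)
      rw [← Function.iterate_succ_apply] at h
      exact IsPath.cons p μ h

/-- Length of a straight run. -/
theorem length_linePath (μ : Fin (d + 1)) : ∀ (n : ℕ) (p : ↥(boxDom N)), (linePath μ p n).length = n := by
  intro n
  induction n with
  | zero => intro p; simp [linePath]
  | succ n ih => intro p; simp [linePath, ih]

/-- The bonds of a straight run start at the iterates `sh_μ^i p`, `i < n`. -/
theorem mem_linePath (μ : Fin (d + 1)) : ∀ (n : ℕ) (p : ↥(boxDom N)) (bd : ↥(boxDom N) × Fin (d + 1)),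
    bd ∈ linePath μ p n → ∃ i, i < n ∧ bd = ((tshift N (unitVec μ))^[i] p, μ) := by
  intro n
  induction n with
  | zero => intro p bd h; simp [linePath] at h
  | succ n ih =>
      intro p bd h
      simp only [linePath, List.mem_cons] at h
      rcases h with h | h
      · exact ⟨0, Nat.succ_pos n, by simpa using h⟩
      · obtain ⟨i, hi, e⟩ := ih _ bd h
        exact ⟨i + 1, by omega, by rw [e, Function.iterate_succ_apply]⟩

/-- The axis-by-axis contour toward `x`: along each listed axis `μ`, `x_μ − p_μ` unit steps. -/
def contourFrom (x : ↥(boxDom N)) : List (Fin (d + 1)) → ↥(boxDom N) → List (↥(boxDom N) × Fin (d + 1))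
  | [], _ => []
  | μ :: rest, p => linePath μ p (x.1 μ - p.1 μ).toNat ++
      contourFrom x rest ((tshift N (unitVec μ))^[(x.1 μ - p.1 μ).toNat] p)

/-- Its end point (the same fold). -/
def endPt (x : ↥(boxDom N)) : List (Fin (d + 1)) → ↥(boxDom N) → ↥(boxDom N)
  | [], p => p
  | μ :: rest, p => endPt x rest ((tshift N (unitVec μ))^[(x.1 μ - p.1 μ).toNat] p)

/-- The contour is a connected path from `p` to its end point. -/
theorem isPath_contourFrom (x : ↥(boxDom N)) : ∀ (L : List (Fin (d + 1))) (p : ↥(boxDom N)),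
    IsPath (fun ν => tshift N (unitVec ν)) (contourFrom x L p) p (endPt x L p) := by
  intro L
  induction L with
  | nil => intro p; simpa [contourFrom, endPt] using IsPath.nil p
  | cons μ rest ih => intro p; exact (isPath_linePath μ _ p).append (ih _)

/-- One axis run toward `x` from a point below `x`: the end point has coordinate `μ` equal to `x_μ`, the others unchanged, and
stays below `x`. -/
theorem run_val (x p : ↥(boxDom N)) (μ : Fin (d + 1)) (hle : ∀ i, p.1 i ≤ x.1 i) :
    ((tshift N (unitVec μ))^[(x.1 μ - p.1 μ).toNat] p).1 = fun i => if i = μ then x.1 μ else p.1 i := by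
  have hn : ((x.1 μ - p.1 μ).toNat : ℤ) = x.1 μ - p.1 μ := Int.toNat_of_nonneg (by linarith [hle μ])
  have hx := (mem_boxDom.1 x.2) μ
  rw [iterate_tshift_unitVec_val μ _ p (by rw [hn]; linarith [hx.2])]
  funext i
  by_cases hi : i = μ
  · subst hi; simp only [Pi.add_apply, Pi.smul_apply, unitVec, Pi.single_eq_same, smul_eq_mul, mul_one, if_true, hn]; ring
  · simp [unitVec, hi]

/-- The end point of the contour over the axes `L` from a point `p ≤ x`: coordinates in `L` become those of `x`, the others stay. -/
theorem endPt_val (x : ↥(boxDom N)) : ∀ (L : List (Fin (d + 1))) (p : ↥(boxDom N)), (∀ i, p.1 i ≤ x.1 i) →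
    ∀ i, (endPt x L p).1 i = if i ∈ L then x.1 i else p.1 i := by
  intro L
  induction L with
  | nil => intro p _ i; simp [endPt]
  | cons μ rest ih =>
      intro p hle i
      have hq := run_val x p μ hle
      have hle' : ∀ j, ((tshift N (unitVec μ))^[(x.1 μ - p.1 μ).toNat] p).1 j ≤ x.1 j := fun j => by
        rw [hq]; by_cases hj : j = μ
        · subst hj; simp
        · simp [hj, hle j]
      simp only [endPt]
      rw [ih _ hle' i, hq]
      simp only [List.mem_cons]
      by_cases h1 : i = μ
      · subst h1; simp
      · simp [h1]

/-- Every bond of the contour from `p ≤ x` starts at a point between `p` and `x` (coordinatewise). -/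
theorem mem_contourFrom (x : ↥(boxDom N)) : ∀ (L : List (Fin (d + 1))) (p : ↥(boxDom N)), (∀ i, p.1 i ≤ x.1 i) →
    ∀ bd ∈ contourFrom x L p, ∀ i, p.1 i ≤ bd.1.1 i ∧ bd.1.1 i ≤ x.1 i := by
  intro L
  induction L with
  | nil => intro p _ bd h; simp [contourFrom] at h
  | cons μ rest ih =>
      intro p hle bd h i
      have hq := run_val x p μ hle
      have hle' : ∀ j, ((tshift N (unitVec μ))^[(x.1 μ - p.1 μ).toNat] p).1 j ≤ x.1 j := fun j => by
        rw [hq]; by_cases hj : j = μ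
        · subst hj; simp
        · simp [hj, hle j]
      have hge' : ∀ j, p.1 j ≤ ((tshift N (unitVec μ))^[(x.1 μ - p.1 μ).toNat] p).1 j := fun j => by
        rw [hq]; by_cases hj : j = μ
        · subst hj; simp [hle j]
        · simp [hj]
      simp only [contourFrom, List.mem_append] at h
      rcases h with h | h
      · obtain ⟨n, hn, e⟩ := mem_linePath μ _ p bd h
        have hnle : (n : ℤ) ≤ x.1 μ - p.1 μ := by
          have : ((x.1 μ - p.1 μ).toNat : ℤ) = x.1 μ - p.1 μ := Int.toNat_of_nonneg (by linarith [hle μ])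
          have hn' : (n : ℤ) < ((x.1 μ - p.1 μ).toNat : ℤ) := by exact_mod_cast hn
          linarith
        have hx := (mem_boxDom.1 x.2) μ
        rw [e, iterate_tshift_unitVec_val μ n p (by linarith [hx.2])]
        by_cases hi : i = μ
        · subst hi; simp only [Pi.add_apply, Pi.smul_apply, unitVec, Pi.single_eq_same, smul_eq_mul, mul_one]
          exact ⟨by linarith, by linarith⟩
        · simp [unitVec, Pi.single_eq_of_ne hi, hle i]
      · obtain ⟨h1, h2⟩ := ih _ hle' bd h i
        exact ⟨(hge' i).trans h1, h2⟩

/-- The length of the contour from `p ≤ x` with all gaps `x_i − p_i ≤ m`: at most `|L|·m`. -/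
theorem length_contourFrom_le (x : ↥(boxDom N)) (m : ℕ) : ∀ (L : List (Fin (d + 1))) (p : ↥(boxDom N)),
    (∀ i, p.1 i ≤ x.1 i) → (∀ i, x.1 i - p.1 i ≤ m) → (contourFrom x L p).length ≤ L.length * m := by
  intro L
  induction L with
  | nil => intro p _ _; simp [contourFrom]
  | cons μ rest ih =>
      intro p hle hm
      have hq := run_val x p μ hle
      have hle' : ∀ j, ((tshift N (unitVec μ))^[(x.1 μ - p.1 μ).toNat] p).1 j ≤ x.1 j := fun j => by
        rw [hq]; by_cases hj : j = μ
        · subst hj; simp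
        · simp [hj, hle j]
      have hm' : ∀ j, x.1 j - ((tshift N (unitVec μ))^[(x.1 μ - p.1 μ).toNat] p).1 j ≤ m := fun j => by
        rw [hq]; by_cases hj : j = μ
        · subst hj; simp
        · simp [hj, hm j]
      simp only [contourFrom, List.length_append, length_linePath, List.length_cons]
      have h1 : (x.1 μ - p.1 μ).toNat ≤ m := by
        have := hm μ; omega
      have h2 := ih _ hle' hm'
      calc (x.1 μ - p.1 μ).toNat + (contourFrom x rest _).length ≤ m + rest.length * m := add_le_add h1 h2
        _ = (rest.length + 1) * m := by ring

/-- **The block corner** `b·⌊x∕b⌋` of the `b`-block of `x` (a point of the box, below `x`). -/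
def corner (b : ℕ) (hb : 1 ≤ b) (x : ↥(boxDom N)) : ↥(boxDom N) :=
  ⟨fun i => (b : ℤ) * (x.1 i / (b : ℤ)), mem_boxDom.2 fun i => by
    have hx := (mem_boxDom.1 x.2) i
    have hb0 : (0 : ℤ) < b := by exact_mod_cast hb
    refine ⟨mul_nonneg hb0.le (Int.ediv_nonneg hx.1 hb0.le), lt_of_le_of_lt (Int.mul_ediv_self_le hb0.ne') hx.2⟩⟩

/-- The corner is below `x`, within `b − 1` in every coordinate. -/
theorem corner_le (b : ℕ) (hb : 1 ≤ b) (x : ↥(boxDom N)) (i : Fin (d + 1)) :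
    (corner b hb x).1 i ≤ x.1 i ∧ x.1 i - (corner b hb x).1 i ≤ (b - 1 : ℕ) := by
  have hb0 : (0 : ℤ) < b := by exact_mod_cast hb
  refine ⟨Int.mul_ediv_self_le hb0.ne', ?_⟩
  show x.1 i - (b : ℤ) * (x.1 i / (b : ℤ)) ≤ ((b - 1 : ℕ) : ℤ)
  have h := Int.lt_mul_ediv_self_add (x := x.1 i) hb0
  push_cast [Nat.cast_sub hb]
  linarith

/-- **The corner depends only on the block.** -/
theorem corner_eq_of_blk_eq (b : ℕ) (hb : 1 ≤ b) {x x' : ↥(boxDom N)} (h : blk b x'.1 = blk b x.1) :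
    corner b hb x' = corner b hb x := by
  apply Subtype.ext
  funext i
  show (b : ℤ) * (x'.1 i / (b : ℤ)) = (b : ℤ) * (x.1 i / (b : ℤ))
  have := congrFun h i
  simp only [blk] at this
  rw [this]

/-- A point squeezed between the corner of `x` and `x` lies in the `b`-block of `x`. -/
theorem blk_eq_of_between (b : ℕ) (hb : 1 ≤ b) {x : ↥(boxDom N)} {z : Fin (d + 1) → ℤ}
    (h : ∀ i, (corner b hb x).1 i ≤ z i ∧ z i ≤ x.1 i) : blk b z = blk b x.1 := by
  have hb0 : (0 : ℤ) < b := by exact_mod_cast hb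
  funext i
  obtain ⟨h1, h2⟩ := h i
  change (b : ℤ) * (x.1 i / (b : ℤ)) ≤ z i at h1
  simp only [blk]
  refine le_antisymm (Int.ediv_le_ediv hb0 h2) (Int.le_ediv_of_mul_le hb0 ?_)
  rw [mul_comm]; exact h1

/-- **THE CANONICAL BLOCK CONTOUR** `Γ_x`: axis by axis from the corner of the `b`-block of `x` to `x`.
[cite: Balaban1985BackgroundPropagators, (3.8) p.392] -/
def blockContour (b : ℕ) (hb : 1 ≤ b) (x : ↥(boxDom N)) : List (↥(boxDom N) × Fin (d + 1)) :=
  contourFrom x (List.finRange (d + 1)) (corner b hb x)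

/-- **It is connected, from the corner to `x`.** [cite: Balaban1985BackgroundPropagators, (3.8) p.392] -/
theorem isPath_blockContour (b : ℕ) (hb : 1 ≤ b) (x : ↥(boxDom N)) :
    IsPath (fun ν => tshift N (unitVec ν)) (blockContour b hb x) (corner b hb x) x := by
  have h := isPath_contourFrom x (List.finRange (d + 1)) (corner b hb x)
  have e : endPt x (List.finRange (d + 1)) (corner b hb x) = x := by
    apply Subtype.ext; funext i
    rw [endPt_val x _ _ (fun j => (corner_le b hb x j).1) i, if_pos (List.mem_finRange i)]
  rw [e] at h
  exact h

/-- **Its length is at most `(d+1)(b−1)`.** [cite: Balaban1985BackgroundPropagators, (3.8) p.392] -/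
theorem length_blockContour_le (b : ℕ) (hb : 1 ≤ b) (x : ↥(boxDom N)) : (blockContour b hb x).length ≤ (d + 1) * (b - 1) := by
  have h := length_contourFrom_le x (b - 1) (List.finRange (d + 1)) (corner b hb x) (fun j => (corner_le b hb x j).1)
    (fun j => (corner_le b hb x j).2)
  rwa [List.length_finRange] at h

/-- **It stays inside the `b`-block of `x`** (every bond's base point). [cite: Balaban1985BackgroundPropagators, (3.8) p.392] -/
theorem blk_eq_of_mem_blockContour (b : ℕ) (hb : 1 ≤ b) (x : ↥(boxDom N)) :
    ∀ bd ∈ blockContour b hb x, blk b bd.1.1 = blk b x.1 := fun bd hbd =>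
  blk_eq_of_between b hb (mem_contourFrom x _ _ (fun j => (corner_le b hb x j).1) bd hbd)

end Torus

/-! ## §3. On [4]'s nested family: the level-dependent block contours and base points -/

section MultiLevel

variable {d ℓ Mh k R : ℕ} {P : Fin (d + 1) → ℕ} (D : TDomains d ℓ Mh k P R)

/-- `1 ≤ L^j`. -/
theorem one_le_pow_side (j : ℕ) : 1 ≤ (ℓ + 1) ^ j := Nat.one_le_pow _ _ (Nat.succ_pos ℓ)

/-- **The level-dependent block contour** `Γ x` of the nested family: the canonical contour inside the `L^{lev x}`-block of `x`.
[cite: Balaban1985BackgroundPropagators, (3.8) p.392; Balaban1984PropagatorsII, (2.13)–(2.14) p.225] -/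
def levContour (x : ↥(boxDom (N0 ℓ Mh k P))) : List (↥(boxDom (N0 ℓ Mh k P)) × Fin (d + 1)) :=
  blockContour ((ℓ + 1) ^ D.lev x.1) (one_le_pow_side _) x

/-- **Its base point** (the corner of the `L^{lev x}`-block of `x`). -/
def levBase (x : ↥(boxDom (N0 ℓ Mh k P))) : ↥(boxDom (N0 ℓ Mh k P)) :=
  corner ((ℓ + 1) ^ D.lev x.1) (one_le_pow_side _) x

/-- Connectedness: `Γ x` runs from `levBase x` to `x`. -/
theorem isPath_levContour (x : ↥(boxDom (N0 ℓ Mh k P))) :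
    IsPath (fun ν => tshift (N0 ℓ Mh k P) (unitVec ν)) (levContour D x) (levBase D x) x :=
  isPath_blockContour _ _ x

/-- Base constancy on averaging blocks: `blk_{L^{lev x}} x′ = blk_{L^{lev x}} x ⟹ levBase x′ = levBase x` (levels agree on such blocks,
`TDomains.lev_eq_of_blk_eq`). -/
theorem levBase_eq_of_blk_eq (x x' : ↥(boxDom (N0 ℓ Mh k P)))
    (h : blk ((ℓ + 1) ^ D.lev x.1) x'.1 = blk ((ℓ + 1) ^ D.lev x.1) x.1) : levBase D x' = levBase D x := by
  have hl : D.lev x'.1 = D.lev x.1 := D.lev_eq_of_blk_eq x.2 x'.2 h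
  have hc : ∀ (b b' : ℕ) (hb : 1 ≤ b) (hb' : 1 ≤ b'), b = b' →
      corner (N := N0 ℓ Mh k P) b hb x' = corner b' hb' x' := by
    intro b b' hb hb' e; subst e; rfl
  unfold levBase
  rw [hc ((ℓ + 1) ^ D.lev x'.1) ((ℓ + 1) ^ D.lev x.1) (one_le_pow_side _) (one_le_pow_side _) (by rw [hl])]
  exact corner_eq_of_blk_eq _ _ h

/-- Length: `|Γ x| ≤ (d+1)·L^{lev x}`. -/
theorem length_levContour_le (x : ↥(boxDom (N0 ℓ Mh k P))) : (levContour D x).length ≤ (d + 1) * (ℓ + 1) ^ D.lev x.1 :=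
  (length_blockContour_le _ _ x).trans (Nat.mul_le_mul_left _ (Nat.sub_le _ _))

/-- In-block: every bond of `Γ x` starts in the `L^{lev x}`-block of `x`. -/
theorem blk_eq_of_mem_levContour (x : ↥(boxDom (N0 ℓ Mh k P))) :
    ∀ bd ∈ levContour D x, blk ((ℓ + 1) ^ D.lev x.1) bd.1.1 = blk ((ℓ + 1) ^ D.lev x.1) x.1 :=
  blk_eq_of_mem_blockContour _ _ x

end MultiLevel

end Summit.QuantumFields.BalabanUV.Gaps.D4WalkBlockContourPath

end
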